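import Summits.QuantumFields.YangMills.Theorems.UnitScaleTiltProp7SPrintIn19Dict
import Summits.QuantumFields.YangMills.Theorems.UnitScaleTiltProp7TPrintDefs
import Summits.QuantumFields.YangMills.Theorems.UnitScaleTiltProp7SmoothUntwistDatum
import Summits.QuantumFields.YangMills.Theorems.UnitScaleTiltProp7ExactCorrectorGaugeSockets
import Literature.MathematicalPhysics.QuantumFieldTheory.Balaban1983to89.B9Eq310Hermitian
import HarnessLib

/-!
# Route `UnitScaleTilt`, crux K1 «MinimiserStabilityRegPr» (stmt-QuantumFields-19200), route-R E′ path (α′), (E1) Thm-2 datum socket — DICTIONARY (P1 of LOCATE «HDATUM-OF-THM2S»):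
# print's (19) AT THE T³ CARRIER (lit `T3SectALandauChart.In19 F n K ε₂ W U₁ X`, the conclusion currency of ✓ `Prop7CovOfThm2.cov_of_thm2SetupSUAt`) ⟹ THE (E1)-DOOR's DATUM ROWS
# (✓ `Prop7PinnedSliceRowOfThm2Datum.pinnedSliceRow_of_thm2Datum`'s `hDatum` letters): `U₁ = expHermField X`, `X` Hermitian-traceless, `ℓ·‖fun μ z => X ⟨z,μ⟩‖ ≤ ε₂`,
# `ℓ²·‖fun x => divB 𝒰 (fun μ z => X ⟨z,μ⟩) x‖ ≤ 3ε₂` (`ℓ = L^{K−n} = η⁻¹`, `𝒰 = bgUnits W`)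

Cell `ym3-torus`, width seat `ym3-torus-px13` (gen 4); LOCATE «HDATUM-OF-THM2S» (19200 evidence n = 40, 2026-08-29) piece (P1).  THEOREMS ONLY (0 `def`, 0 `sorry`, 0 `instance`);
`--supports stmt-QuantumFields-19200`, count-neutral.  YM₃ on T³ is a ladder rung (R3), not the Clay problem; nothing here claims the stub, the crux, d = 4 or the gap.

WHY.  The E′ display v5 (✓p684177) shows, on the E1 side, the Thm-2 datum socket `hDatum` in the letters of ✓ `exists_untwistedStart_En_T3` (`A₀` Hermitian-traceless, `ℓ‖A₀‖ ≤ s₀`,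
`ℓ²‖D*_𝒰A₀‖ ≤ s₁′`, …).  [Balaban1985Variational] Prop. 2 — in the tree as COV from [Balaban1985RegularSpaces] Thm 2, ✓ `cov_of_thm2SetupSUAt` — delivers the Landau datum as
`In19 F n K ε₂ W U₁ X` ((19) p. 281: `X` Hermitian-traceless, `U₁ = e^{iX}` bondwise, `‖X‖ < ε₂η`, `‖∇¹_W X‖ < ε₂η²`, …).  THIS FILE reads (19) in the door's currency: the sup row is the
`Pi` norm (`ℓη = 1`), and the divergence row follows from the GRADIENT member, k-uniformly — `D*_μ G(x) = −R(𝒰(x−e_μ))⁻¹·(D_μ G)(x−e_μ)` and `‖R(·)‖ ≤ ‖·‖` at a unitary background, so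
`‖D*_𝒰X(x)‖ ≤ Σ_μ ‖(∇¹_W X)_{μμ}(x−e_μ)‖ < d·ε₂η²`.

WHAT IS PROVED (ns `…Theorems.Prop7In19DatumRows`).
* §1 `covGradT_one_eq_covD` — `(∇¹_W X)_{μν}(x) = D_{𝒰,μ}(X_ν)(x)` (`T3SectALandauChart.covGradT` at `η = 1` IS `B9Eq39Adjoint.covD` on the torus); `covDstar_eq_neg_R_covD` —
  `D*_μ G (x) = −R(𝒰_μ(x−e_μ))⁻¹ (D_μ G (x−e_μ))`; `norm_covDstar_le_norm_covD` (unitary background); `norm_divB_le_sum_covGradT` — `‖D*_𝒰X (x)‖ ≤ Σ_μ ‖(∇¹_W X)_{μμ}(x−e_μ)‖`.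
* §2 ★★ `datumRows_of_in19` — `In19 F n K ε₂ W U₁ X ⟹ U₁ = expHermField X ∧ (∀ b, (X b).IsHermitian ∧ tr (X b) = 0) ∧ ℓ·‖fun μ z => X ⟨z,μ⟩‖ ≤ ε₂ ∧ ℓ²·‖fun x => divB 𝒰 (fun μ z => X ⟨z,μ⟩) x‖ ≤ 3·ε₂`
  — the door's `hA0 ∕ hs₀ ∕ hs₁` rows with `A₀ := X`, `s₀ := ε₂`, `s₁′ := 3ε₂`.
HONEST SCOPE.  Letter bookkeeping between two typings of the same printed operators; no estimate of Bałaban's is proved; (19) is a HYPOTHESIS (COV's output).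

References: T. Bałaban, CMP 102 (1985) 277–309 [Balaban1985Variational] ((19) p.281, Prop. 2 p.281); CMP 99 (1985) 389–434 [Balaban1985BackgroundPropagators] ((3.3) p.390, (3.5) p.391,
(3.8) p.392); CMP 99 (1985) 75–102 [Balaban1985RegularSpaces] ((1.1) p.76, (1.36) p.82).
-/

set_option autoImplicit false

noncomputable section

open scoped BigOperators Matrix.Norms.L2Operator Matrix
open NormedSpace

namespace Summit.QuantumFields.YangMills.Theorems.Prop7In19DatumRows

open Literature.MathematicalPhysics.QuantumFieldTheory.Balaban1983to89
open Literature.MathematicalPhysics.QuantumFieldTheory.Balaban1983to89.T3ContinuumYM3Torus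
open Literature.MathematicalPhysics.QuantumFieldTheory.Balaban1983to89.T3SectALandauChart (In19 eta eta_pos bgUnits covGradT covDerivFwdT formComp)
open T4Continuum
open B9Eq39Adjoint (R R_def R_sub R_inv_R covD covDstar divB)
open B9TorusCalculus (torusT torusT_apply torusT_symm_apply)
open B10Eq27TorusAxialLog (unitsField toUField)
open B7Eq78Linearization (conjR conjR_apply)
open B9Eq310Hermitian (norm_R_le)
open Summit.QuantumFields.YangMills.Theorems.Prop7TPrint (expHerm expHermField expHermField_apply coe_expHerm)
open Summit.QuantumFields.YangMills.Theorems.Prop7SPrintIn19 (pow_mul_eta)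
open Summit.QuantumFields.YangMills.Theorems.Prop7SmoothUntwistDatum (blockLetter_eq)
open Summit.QuantumFields.YangMills.Theorems.Prop7SmoothUntwistSocket (pi_norm_bond_le_iff)
open Summit.QuantumFields.YangMills.Theorems.Prop7ExactCorrectorGaugeSockets (unitsField_toUField_norm_le_one)

variable {F : T3Family} {n K : ℕ}

/-! ## §1 The operator dictionary: (19)'s gradient at `η = 1` is `covD`; `D*` through `D` -/

/-- `(∇¹_W X)_{μν}(x) = (D_{𝒰,μ} X_ν)(x)` — `covGradT 1 (bgUnits W) X μ ν x = covD (torusT) 𝒰 μ (fun z => X ⟨z, ν⟩) x`, `𝒰 κ z = unitsField (toUField W) ⟨z, κ⟩`.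
[cite: Balaban1985RegularSpaces, (1.1) p.76; Balaban1985BackgroundPropagators, (3.3) p.390] -/
theorem covGradT_one_eq_covD (W : GaugeField (F.P K) 0 (Matrix.specialUnitaryGroup (Fin 2) ℂ)) (X : PBond (F.P K) 0 → Matrix (Fin 2) (Fin 2) ℂ)
    (μ ν : Fin (F.P K).d) (x : Site (F.P K) 0) :
    covGradT 1 (bgUnits F K W) X μ ν x = covD (torusT (F.P K) 0) (fun κ z => unitsField (toUField W) ⟨z, κ⟩) μ (fun z => X ⟨z, ν⟩) x := by
  simp only [covGradT, covDerivFwdT, formComp, inv_one, one_smul, conjR_apply, covD, R_def, torusT_apply]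
  rfl

/-- `D*_μ G (x) = −R(𝒰_μ(x − e_μ))⁻¹ (D_μ G (x − e_μ))` ((3.8) through (3.3) and (3.5)). [cite: Balaban1985BackgroundPropagators, (3.8) p.392, (3.5) p.391, (3.3) p.390] -/
theorem covDstar_eq_neg_R_covD {S ι 𝔸 : Type*} [Ring 𝔸] (T : ι → Equiv.Perm S) (U : ι → S → 𝔸ˣ) (μ : ι) (G : S → 𝔸) (x : S) :
    covDstar T U μ G x = -R (U μ ((T μ).symm x))⁻¹ (covD T U μ G ((T μ).symm x)) := by
  simp only [covDstar, covD, R_sub, R_inv_R, Equiv.apply_symm_apply, neg_sub]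

/-- `‖D*_μ G (x)‖ ≤ ‖D_μ G (x − e_μ)‖` at an `SU(2)` background (unitary transport does not increase the norm).
[cite: Balaban1985BackgroundPropagators, (3.8) p.392, (3.5) p.391] -/
theorem norm_covDstar_le_norm_covD (W : GaugeField (F.P K) 0 (Matrix.specialUnitaryGroup (Fin 2) ℂ)) (μ : Fin (F.P K).d)
    (G : Site (F.P K) 0 → Matrix (Fin 2) (Fin 2) ℂ) (x : Site (F.P K) 0) :
    ‖covDstar (torusT (F.P K) 0) (fun κ z => unitsField (toUField W) ⟨z, κ⟩) μ G x‖
      ≤ ‖covD (torusT (F.P K) 0) (fun κ z => unitsField (toUField W) ⟨z, κ⟩) μ G ((torusT (F.P K) 0 μ).symm x)‖ := by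
  rw [covDstar_eq_neg_R_covD, norm_neg]
  have hU := unitsField_toUField_norm_le_one W ⟨(torusT (F.P K) 0 μ).symm x, μ⟩
  exact norm_R_le hU.2 (by rw [inv_inv]; exact hU.1) _

/-- `‖D*_𝒰 X (x)‖ ≤ Σ_μ ‖(∇¹_W X)_{μμ}(x − e_μ)‖` — the divergence through the GRADIENT member of (19), k-uniformly.
[cite: Balaban1985BackgroundPropagators, (3.8) p.392; Balaban1985Variational, (19) p.281] -/
theorem norm_divB_le_sum_covGradT (W : GaugeField (F.P K) 0 (Matrix.specialUnitaryGroup (Fin 2) ℂ)) (X : PBond (F.P K) 0 → Matrix (Fin 2) (Fin 2) ℂ)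
    (x : Site (F.P K) 0) :
    ‖divB (torusT (F.P K) 0) (fun κ z => unitsField (toUField W) ⟨z, κ⟩) (fun μ z => X ⟨z, μ⟩) x‖
      ≤ ∑ μ : Fin (F.P K).d, ‖covGradT 1 (bgUnits F K W) X μ μ ((torusT (F.P K) 0 μ).symm x)‖ := by
  refine (norm_sum_le _ _).trans (Finset.sum_le_sum fun μ _ => ?_)
  rw [covGradT_one_eq_covD]
  exact norm_covDstar_le_norm_covD W μ (fun z => X ⟨z, μ⟩) x

/-! ## §2 (19) ⟹ the door's datum rows -/

/-- ★★ **PRINT'S (19) IN THE (E1)-DOOR'S DATUM CURRENCY**: `In19 F n K ε₂ W U₁ X` gives `U₁ = expHermField X`, `X` Hermitian-traceless (the door's `hA0`), the sup row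
`ℓ·‖fun μ z => X ⟨z,μ⟩‖ ≤ ε₂` (`hs₀`, `s₀ := ε₂`) and the divergence row `ℓ²·‖fun x => divB 𝒰 (fun μ z => X ⟨z,μ⟩) x‖ ≤ 3·ε₂` (`hs₁`, `s₁′ := 3ε₂`), `ℓ = L^{K−n}`.
[cite: Balaban1985Variational, (19) p.281, Prop. 2 p.281; Balaban1985RegularSpaces, (1.36) p.82; Balaban1985BackgroundPropagators, (3.8) p.392] -/
theorem datumRows_of_in19 {ε₂ : ℝ} (W U₁ : GaugeField (F.P K) 0 (Matrix.specialUnitaryGroup (Fin 2) ℂ)) (X : PBond (F.P K) 0 → Matrix (Fin 2) (Fin 2) ℂ)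
    (h19 : In19 F n K ε₂ W U₁ X) :
    U₁ = expHermField X ∧
    (∀ b : PBond (F.P K) 0, (X b).IsHermitian ∧ Matrix.trace (X b) = 0) ∧
    ((((F.P K).L ^ (K - n) : ℕ)) : ℝ) * ‖(fun (μ : Fin (F.P K).d) (z : Site (F.P K) 0) => X ⟨z, μ⟩)‖ ≤ ε₂ ∧
    (∀ x : Site (F.P K) 0, ((((F.P K).L ^ (K - n) : ℕ)) : ℝ) ^ 2 *
      ‖divB (torusT (F.P K) 0) (fun κ z => unitsField (toUField W) ⟨z, κ⟩) (fun μ z => X ⟨z, μ⟩) x‖ ≤ 3 * ε₂) ∧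
    ((((F.P K).L ^ (K - n) : ℕ)) : ℝ) ^ 2 *
      ‖(fun x => divB (torusT (F.P K) 0) (fun κ z => unitsField (toUField W) ⟨z, κ⟩) (fun μ z => X ⟨z, μ⟩) x)‖ ≤ 3 * ε₂ := by
  obtain ⟨hHerm, hexp, hsup, hgrad, -, -⟩ := h19
  -- sizes
  set ℓ : ℝ := (F.L : ℝ) ^ (K - n) with hℓdef
  have hη : 0 < eta F n K := eta_pos F n K
  have hℓη : ℓ * eta F n K = 1 := pow_mul_eta F n K
  have hℓ0 : 0 < ℓ := by
    rw [hℓdef]; exact pow_pos (by have := F.hL.2; exact_mod_cast (by omega : 0 < F.L)) _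
  have hblock : ((((F.P K).L ^ (K - n) : ℕ)) : ℝ) = ℓ := blockLetter_eq F K n
  have hd : (F.P K).d = 3 := rfl
  -- a bond exists, so `0 < ε₂`
  have b₀ : PBond (F.P K) 0 := ⟨Classical.arbitrary _, ⟨0, by rw [hd]; norm_num⟩⟩
  have hε₂ : 0 < ε₂ := by
    have h : 0 * eta F n K < ε₂ * eta F n K := by rw [zero_mul]; exact (norm_nonneg _).trans_lt (hsup b₀)
    exact lt_of_mul_lt_mul_right h hη.le
  refine ⟨?_, hHerm, ?_, ?_, ?_⟩
  · -- `U₁ = expHermField X`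
    funext b
    apply Subtype.ext
    rw [hexp b, expHermField_apply, coe_expHerm (hHerm b)]
  · -- sup row
    rw [hblock]
    have hpi : ‖(fun (μ : Fin (F.P K).d) (z : Site (F.P K) 0) => X ⟨z, μ⟩)‖ ≤ ε₂ * eta F n K :=
      (pi_norm_bond_le_iff _ (by positivity)).2 fun μ z => (hsup ⟨z, μ⟩).le
    calc ℓ * ‖(fun (μ : Fin (F.P K).d) (z : Site (F.P K) 0) => X ⟨z, μ⟩)‖ ≤ ℓ * (ε₂ * eta F n K) :=
          mul_le_mul_of_nonneg_left hpi hℓ0.le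
      _ = ε₂ * (ℓ * eta F n K) := by ring
      _ = ε₂ := by rw [hℓη, mul_one]
  · -- divergence row, pointwise
    intro x
    rw [hblock]
    have hpt : ‖divB (torusT (F.P K) 0) (fun κ z => unitsField (toUField W) ⟨z, κ⟩) (fun μ z => X ⟨z, μ⟩) x‖ ≤ 3 * (ε₂ * eta F n K ^ 2) := by
      refine (norm_divB_le_sum_covGradT W X x).trans ?_
      calc ∑ μ : Fin (F.P K).d, ‖covGradT 1 (bgUnits F K W) X μ μ ((torusT (F.P K) 0 μ).symm x)‖
          ≤ ∑ _μ : Fin (F.P K).d, ε₂ * eta F n K ^ 2 := Finset.sum_le_sum fun μ _ => (hgrad μ μ _).le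
        _ = 3 * (ε₂ * eta F n K ^ 2) := by rw [Finset.sum_const, Finset.card_univ, Fintype.card_fin, hd]; simp
    calc ℓ ^ 2 * ‖divB (torusT (F.P K) 0) (fun κ z => unitsField (toUField W) ⟨z, κ⟩) (fun μ z => X ⟨z, μ⟩) x‖
        ≤ ℓ ^ 2 * (3 * (ε₂ * eta F n K ^ 2)) := mul_le_mul_of_nonneg_left hpt (by positivity)
      _ = 3 * ε₂ * (ℓ * eta F n K) ^ 2 := by ring
      _ = 3 * ε₂ := by rw [hℓη, one_pow, mul_one]
  · -- divergence row, `Pi` norm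
    rw [hblock]
    have hpi : ‖(fun x => divB (torusT (F.P K) 0) (fun κ z => unitsField (toUField W) ⟨z, κ⟩) (fun μ z => X ⟨z, μ⟩) x)‖ ≤ 3 * (ε₂ * eta F n K ^ 2) := by
      refine (pi_norm_le_iff_of_nonneg (by positivity)).2 fun x => ?_
      refine (norm_divB_le_sum_covGradT W X x).trans ?_
      calc ∑ μ : Fin (F.P K).d, ‖covGradT 1 (bgUnits F K W) X μ μ ((torusT (F.P K) 0 μ).symm x)‖
          ≤ ∑ _μ : Fin (F.P K).d, ε₂ * eta F n K ^ 2 := Finset.sum_le_sum fun μ _ => (hgrad μ μ _).le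
        _ = 3 * (ε₂ * eta F n K ^ 2) := by rw [Finset.sum_const, Finset.card_univ, Fintype.card_fin, hd]; simp
    calc ℓ ^ 2 * ‖(fun x => divB (torusT (F.P K) 0) (fun κ z => unitsField (toUField W) ⟨z, κ⟩) (fun μ z => X ⟨z, μ⟩) x)‖
        ≤ ℓ ^ 2 * (3 * (ε₂ * eta F n K ^ 2)) := mul_le_mul_of_nonneg_left hpi (by positivity)
      _ = 3 * ε₂ * (ℓ * eta F n K) ^ 2 := by ring
      _ = 3 * ε₂ := by rw [hℓη, one_pow, mul_one]

end Summit.QuantumFields.YangMills.Theorems.Prop7In19DatumRows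

end
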